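import Mathlib
import HarnessLib
import Literature.Analysis.FluidPDE.ClassicalSolution
import Summits.NavierStokesRegularity.NavierStokesRegularity.Theorems.UnthreadedRigidityDoorUnthreadedRigidityThreadingJetsSlice
import Summits.NavierStokesRegularity.NavierStokesRegularity.Theorems.UnthreadedRigidityDoorUnthreadedRigidityThreadingJetsWindowGeneric
import Summits.NavierStokesRegularity.NavierStokesRegularity.Theorems.UnthreadedRigidityDoorUnthreadedRigidityThreadingJetsVirialCompositions
import Summits.NavierStokesRegularity.NavierStokesRegularity.Theorems.UnthreadedRigidityDoorUnthreadedRigidityVirialHornCompositions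
import Summits.NavierStokesRegularity.NavierStokesRegularity.Theorems.UnthreadedRigidityDoorUnthreadedRigidityVirialHornAngularLemma
import Summits.NavierStokesRegularity.NavierStokesRegularity.Theorems.UnthreadedRigidityDoorUnthreadedRigidityVirialHornBridgeWOfInjective

/-!
# THREADING JETS, RUNG CLOSURES: the SLICE RUNG up to the PLATEAU DICHOTOMY (bridge V) and the WINDOW RUNG up to BRACKET INJECTIVITY (bridge W)

W2 ⟨stmt-NavierStokesRegularity-27585⟩ `UnthreadedRigidity`, line g11-1 (VIRIAL HORN), director dss_155 («compose `OrderTwoSliceLawGeneric`, then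
bridge V `OrderTwoVirialIdentity` by name if it is L-only glue»).  With the all-degree ANGULAR LEMMA `VirialHorn.angularLemma_holds` (ns-engine-1),
bridge V-W `virialWindowSilence_holds` (file `…VirialCompositions`) and bridge W ⇐ bracket injectivity `windowWedgeAnalyticL_of_bracketInjective`
(ns-crc-p2) in the tree, the two rungs of the line close BY NAME up to exactly one residual each — kernel-checked here, no new definitions:

SLICE SIDE (bridge V).  ANSWER to dss_155: bridge V is L-only glue MODULO THE PLATEAU DICHOTOMY of the vorticity amplitude `K = vortAmpL l H`
— «`K` vanishes on no sub-interval of `(0,∞)`, or `K ≡ 0` there» — and nothing else: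
* `sliceLaw_of_dichotomy` — the typed slice law `OrderTwoSliceLaw` for every profile satisfying the dichotomy (generic branch:
  `orderTwoSliceLawGeneric_holds`; null branch: `virialMoment_eq_zero_of_vortAmpL_eq_zero`); `sliceLaw_of_analyticProfile` — in particular for
  every profile real-analytic on `(0,∞)` (`vortAmpL_generic_or_zero`).
* `orderTwoVirialIdentity_of_dichotomy` / `…_of_analyticProfile` — the statement of `VirialHorn.OrderTwoVirialIdentity` VERBATIM with the dichotomy
  (resp. analyticity of `H` on `(0,∞)`) inserted after `VirialAdmissible l H`; `orderTwoVirialIdentity_of_forall_dichotomy` — bridge V by name IF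
  every
  admissible profile satisfied the dichotomy (it does not: smooth plateau profiles are admissible).
* ★ `isSliceAxisymmetric_of_dichotomy` / `…_of_analyticProfile` — the separable slice rung `VirialHorn.SeparableOrderTwoRigidityL` VERBATIM with the
  dichotomy inserted, NO OTHER INPUT (S-C `angularLemma_holds`, S-V `virialNondegeneracy_holds`, S-Z `zonalShellAxisym_holds`, g7's composition
  pointwise); `separableOrderTwoRigidityL_of_forall_dichotomy`.

WINDOW SIDE (bridge W).
* ★ `isotypicWindowRigidityL_of_bridgeW'` — `IsotypicWindowRigidityL l n` for every `l ≥ 1` from bridge W `WindowWedgeAnalyticL` ALONE;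
  ★ `isotypicWindowRigidityL_of_bracketInjective` — … from BRACKET INJECTIVITY alone (crc-p2's `hinj`, KEY-NS #210; T2's all-`l` proof of record).

RESIDUAL R1 (of record since the ORDER-TWO SLICE LAW was typed, now kernel-sharp): for virial-admissible profiles whose `K` vanishes on a proper
sub-annulus but not identically (smooth NON-ANALYTIC PLATEAU profiles — `H ≡ c` near `0`, the potential tail `c′r^{−2l−1}` near `∞`, anything
between) the order-two silence `fluxJetTwo ≡ 0` constrains the data only where `K ≠ 0`; neither the harmonic-free virial lemma nor (F3) concludes,
and no counterexample is known; bridge V `OrderTwoVirialIdentity`, `OrderTwoSliceLaw` and the slice rung AS TYPED stay OPEN exactly there (planner's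
call whether they should carry the dichotomy).  In WINDOWS the dichotomy is automatic (analytic slices).  HONEST LABEL: both rungs concern SPECIAL
(separable / isotypic) data and HYPOTHETICAL silent windows; MODEL rung; ⟨27585⟩, W2 and NS regularity OPEN — no NS regularity statement is proved.
-/

noncomputable section

-- the summit and its single sub-problem share the name (CONVENTIONS §1), as in every Theorems file
set_option linter.dupNamespace false

namespace Summit.NavierStokesRegularity.NavierStokesRegularity.Theorems.UnthreadedRigidity.ThreadingJets

open Set Filter Topology MeasureTheory
open scoped ContDiff Laplacian
open Literature.Analysis.FluidPDE
open Summit.NavierStokesRegularity.NavierStokesRegularity.Theorems.UnthreadedRigidity.ProfileHorn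
  (E3 threadingFlux IsSliceAxisymmetric isSliceAxisymmetric_of_eq_zero)
open Summit.NavierStokesRegularity.NavierStokesRegularity.Theorems.UnthreadedRigidity.VirialHorn
  (IsSolidHarmonic VirialAdmissible sepShellL virialMoment angForm vortAmpL pbr AngularLemma SeparableOrderTwoRigidityL
    WindowWedgeAnalyticL IsotypicWindowRigidityL sepShellL_null virialNondegeneracy_holds zonalShellAxisym_holds angularLemma_holds
    separableOrderTwoRigidityL_of_identity windowWedgeAnalyticL_of_bracketInjective)

/-- a profile real-analytic on `(0,∞)` satisfies the PLATEAU DICHOTOMY «`K = vortAmpL l H` vanishes on no sub-interval of `(0,∞)`, or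
identically there» (isolated zeros: `vortAmpL_generic_or_zero`, file `…WindowGeneric`); smooth plateau profiles are exactly the failures. -/
theorem plateauDichotomy_of_analytic {l : ℕ} {H : ℝ → ℝ} (hHa : AnalyticOnNhd ℝ H (Set.Ioi 0)) :
    (∀ a b : ℝ, 0 < a → a < b → ∃ r ∈ Set.Ioo a b, vortAmpL l H r ≠ 0) ∨ (∀ r : ℝ, 0 < r → vortAmpL l H r = 0) :=
  vortAmpL_generic_or_zero hHa

/-! ### The slice law under the dichotomy -/

/-- ★ THE ORDER-TWO SLICE LAW FOR EVERY NON-PLATEAU PROFILE: the body of `OrderTwoSliceLaw` with the plateau dichotomy of `H` added —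
generic branch by `orderTwoSliceLawGeneric_holds`, null branch by `virialMoment_eq_zero_of_vortAmpL_eq_zero`. -/
theorem sliceLaw_of_dichotomy (l : ℕ) (x₀ : E3) (Y : E3 → ℝ) (H : ℝ → ℝ) (p₀ : E3 → ℝ)
    (hl : 1 ≤ l) (hY : IsSolidHarmonic l Y) (hH : VirialAdmissible l H)
    (hK : (∀ a b : ℝ, 0 < a → a < b → ∃ r ∈ Set.Ioo a b, vortAmpL l H r ≠ 0) ∨ (∀ r : ℝ, 0 < r → vortAmpL l H r = 0))
    (hsm : ContDiff ℝ (⊤ : ℕ∞) (sepShellL H Y x₀)) (hdiv : VectorCalculus.IsDivFree (sepShellL H Y x₀))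
    (hp : ContDiff ℝ (⊤ : ℕ∞) p₀)
    (hpoi : ∀ x : E3, (Δ p₀) x = -VectorCalculus.divergence (convect (sepShellL H Y x₀) (sepShellL H Y x₀)) x)
    (hdec : Tendsto p₀ (cocompact E3) (𝓝 0)) (hj : ∀ x : E3, fluxJetTwo (sepShellL H Y x₀) p₀ x₀ x = 0) :
    ∀ ξ : E3, virialMoment l H * angForm Y ξ = 0 := by
  intro ξ
  rcases hK with hgen | hzero
  · exact orderTwoSliceLawGeneric_holds l x₀ Y H p₀ hl hY hH hgen hsm hdiv hp hpoi hdec hj ξ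
  · rw [virialMoment_eq_zero_of_vortAmpL_eq_zero hH hzero, zero_mul]

/-- The slice law for every profile real-analytic on `(0,∞)`. -/
theorem sliceLaw_of_analyticProfile (l : ℕ) (x₀ : E3) (Y : E3 → ℝ) (H : ℝ → ℝ) (p₀ : E3 → ℝ)
    (hl : 1 ≤ l) (hY : IsSolidHarmonic l Y) (hH : VirialAdmissible l H) (hHa : AnalyticOnNhd ℝ H (Set.Ioi 0))
    (hsm : ContDiff ℝ (⊤ : ℕ∞) (sepShellL H Y x₀)) (hdiv : VectorCalculus.IsDivFree (sepShellL H Y x₀))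
    (hp : ContDiff ℝ (⊤ : ℕ∞) p₀)
    (hpoi : ∀ x : E3, (Δ p₀) x = -VectorCalculus.divergence (convect (sepShellL H Y x₀) (sepShellL H Y x₀)) x)
    (hdec : Tendsto p₀ (cocompact E3) (𝓝 0)) (hj : ∀ x : E3, fluxJetTwo (sepShellL H Y x₀) p₀ x₀ x = 0) :
    ∀ ξ : E3, virialMoment l H * angForm Y ξ = 0 :=
  sliceLaw_of_dichotomy l x₀ Y H p₀ hl hY hH (plateauDichotomy_of_analytic hHa) hsm hdiv hp hpoi hdec hj

/-! ### Bridge V under the dichotomy -/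

/-- ★ BRIDGE V FOR EVERY NON-PLATEAU PROFILE: the statement of `VirialHorn.OrderTwoVirialIdentity` verbatim with the plateau dichotomy of `H`
inserted — a classical Navier–Stokes solution on `[t₀, T)` with decaying pressure, issued from the separable shell `sepShellL H Y x₀`, whose
threading flux is order-two silent at `t₀`, has `virialMoment l H · angForm Y ≡ 0`.  (Jet dictionary of file `…ThreadingJetsSlice`.) -/
theorem orderTwoVirialIdentity_of_dichotomy (l : ℕ) (t₀ T : ℝ) (u : ℝ → E3 → E3) (p : ℝ → E3 → ℝ) (x₀ : E3) (Y : E3 → ℝ) (H : ℝ → ℝ)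
    (hl : 1 ≤ l) (hT : t₀ < T) (h : IsClassicalNSSolutionOn (Set.Ico t₀ T) 1 0 u p)
    (hp : ∀ t ∈ Set.Ico t₀ T, Tendsto (p t) (cocompact E3) (𝓝 0))
    (hY : IsSolidHarmonic l Y) (hH : VirialAdmissible l H)
    (hK : (∀ a b : ℝ, 0 < a → a < b → ∃ r ∈ Set.Ioo a b, vortAmpL l H r ≠ 0) ∨ (∀ r : ℝ, 0 < r → vortAmpL l H r = 0))
    (hu0 : u t₀ = sepShellL H Y x₀)
    (hjet : ∀ x : E3, iteratedDerivWithin 2 (fun t => threadingFlux u x₀ t x) (Set.Ici t₀) t₀ = 0) :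
    ∀ ξ : E3, virialMoment l H * angForm Y ξ = 0 := by
  have ht₀ : t₀ ∈ Ico t₀ T := ⟨le_rfl, hT⟩
  have hsm : ContDiff ℝ ∞ (sepShellL H Y x₀) := by rw [← hu0]; exact h.contDiff_velocity ht₀
  have hdiv : VectorCalculus.IsDivFree (sepShellL H Y x₀) := by rw [← hu0]; exact h.divFree t₀ ht₀
  have hps : ContDiff ℝ ∞ (p t₀) := h.contDiff_pressure ht₀
  have hpoi : ∀ x : E3, (Δ (p t₀)) x =
      -VectorCalculus.divergence (convect (sepShellL H Y x₀) (sepShellL H Y x₀)) x := by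
    intro x
    rw [← hu0]
    exact laplacian_pressure_eq_Ico h hT ht₀ x
  have hj : ∀ x : E3, fluxJetTwo (sepShellL H Y x₀) (p t₀) x₀ x = 0 := by
    intro x
    rw [← hu0, ← iteratedDerivWithin_two_threadingFlux_Ici_eq_fluxJetTwo h hT]
    exact hjet x
  exact sliceLaw_of_dichotomy l x₀ Y H (p t₀) hl hY hH hK hsm hdiv hps hpoi (hp t₀ ht₀) hj

/-- Bridge V for every profile real-analytic on `(0,∞)`. -/
theorem orderTwoVirialIdentity_of_analyticProfile (l : ℕ) (t₀ T : ℝ) (u : ℝ → E3 → E3) (p : ℝ → E3 → ℝ) (x₀ : E3) (Y : E3 → ℝ)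
    (H : ℝ → ℝ) (hl : 1 ≤ l) (hT : t₀ < T) (h : IsClassicalNSSolutionOn (Set.Ico t₀ T) 1 0 u p)
    (hp : ∀ t ∈ Set.Ico t₀ T, Tendsto (p t) (cocompact E3) (𝓝 0))
    (hY : IsSolidHarmonic l Y) (hH : VirialAdmissible l H) (hHa : AnalyticOnNhd ℝ H (Set.Ioi 0)) (hu0 : u t₀ = sepShellL H Y x₀)
    (hjet : ∀ x : E3, iteratedDerivWithin 2 (fun t => threadingFlux u x₀ t x) (Set.Ici t₀) t₀ = 0) :
    ∀ ξ : E3, virialMoment l H * angForm Y ξ = 0 :=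
  orderTwoVirialIdentity_of_dichotomy l t₀ T u p x₀ Y H hl hT h hp hY hH (plateauDichotomy_of_analytic hHa) hu0 hjet

/-- If EVERY virial-admissible profile satisfied the plateau dichotomy, bridge V would hold by name.  (It does not: smooth plateau profiles
are admissible — this records exactly what separates the landed glue from `OrderTwoVirialIdentity` as typed.) -/
theorem orderTwoVirialIdentity_of_forall_dichotomy (hD : ∀ (l : ℕ) (H : ℝ → ℝ), 1 ≤ l → VirialAdmissible l H →
      (∀ a b : ℝ, 0 < a → a < b → ∃ r ∈ Set.Ioo a b, vortAmpL l H r ≠ 0) ∨ (∀ r : ℝ, 0 < r → vortAmpL l H r = 0)) :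
    VirialHorn.OrderTwoVirialIdentity := by
  intro l t₀ T u p x₀ Y H hl hT h hp hY hH hu0 hjet
  exact orderTwoVirialIdentity_of_dichotomy l t₀ T u p x₀ Y H hl hT h hp hY hH (hD l H hl hH) hu0 hjet

/-! ### The separable slice rung under the dichotomy -/

/-- ★ THE SEPARABLE SLICE RUNG FOR EVERY NON-PLATEAU PROFILE, NO OTHER INPUT: the statement of `VirialHorn.SeparableOrderTwoRigidityL` verbatim
with the plateau dichotomy inserted (g7's composition pointwise: S-C `angularLemma_holds`, S-V `virialNondegeneracy_holds` in the null-moment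
branch, S-Z `zonalShellAxisym_holds` in the zonal branch). -/
theorem isSliceAxisymmetric_of_dichotomy (l : ℕ) (t₀ T : ℝ) (u : ℝ → E3 → E3) (p : ℝ → E3 → ℝ) (x₀ : E3)
    (Y : E3 → ℝ) (H : ℝ → ℝ) (hl : 1 ≤ l) (hT : t₀ < T) (h : IsClassicalNSSolutionOn (Set.Ico t₀ T) 1 0 u p)
    (hp : ∀ t ∈ Set.Ico t₀ T, Tendsto (p t) (cocompact E3) (𝓝 0))
    (hY : IsSolidHarmonic l Y) (hH : VirialAdmissible l H)
    (hK : (∀ a b : ℝ, 0 < a → a < b → ∃ r ∈ Set.Ioo a b, vortAmpL l H r ≠ 0) ∨ (∀ r : ℝ, 0 < r → vortAmpL l H r = 0))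
    (hu0 : u t₀ = sepShellL H Y x₀)
    (hjet : ∀ x : E3, iteratedDerivWithin 2 (fun t => threadingFlux u x₀ t x) (Set.Ici t₀) t₀ = 0) :
    IsSliceAxisymmetric (u t₀) x₀ := by
  have key := orderTwoVirialIdentity_of_dichotomy l t₀ T u p x₀ Y H hl hT h hp hY hH hK hu0 hjet
  by_cases hm : virialMoment l H = 0
  · have hH0 : ∀ r : ℝ, 0 ≤ r → H r = 0 := virialNondegeneracy_holds l H hl hH hm
    apply isSliceAxisymmetric_of_eq_zero
    intro x
    rw [hu0]
    exact sepShellL_null H Y x₀ hH0 x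
  · have hA : ∀ ξ : E3, angForm Y ξ = 0 := fun ξ => (mul_eq_zero.mp (key ξ)).resolve_left hm
    rw [hu0]
    exact zonalShellAxisym_holds l H Y x₀ hY (angularLemma_holds l Y hY hA) hH

/-- The separable slice rung for every profile real-analytic on `(0,∞)`, no other input. -/
theorem isSliceAxisymmetric_of_analyticProfile (l : ℕ) (t₀ T : ℝ) (u : ℝ → E3 → E3) (p : ℝ → E3 → ℝ) (x₀ : E3)
    (Y : E3 → ℝ) (H : ℝ → ℝ) (hl : 1 ≤ l) (hT : t₀ < T) (h : IsClassicalNSSolutionOn (Set.Ico t₀ T) 1 0 u p)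
    (hp : ∀ t ∈ Set.Ico t₀ T, Tendsto (p t) (cocompact E3) (𝓝 0))
    (hY : IsSolidHarmonic l Y) (hH : VirialAdmissible l H) (hHa : AnalyticOnNhd ℝ H (Set.Ioi 0))
    (hu0 : u t₀ = sepShellL H Y x₀)
    (hjet : ∀ x : E3, iteratedDerivWithin 2 (fun t => threadingFlux u x₀ t x) (Set.Ici t₀) t₀ = 0) :
    IsSliceAxisymmetric (u t₀) x₀ :=
  isSliceAxisymmetric_of_dichotomy l t₀ T u p x₀ Y H hl hT h hp hY hH (plateauDichotomy_of_analytic hHa) hu0 hjet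

/-- If every virial-admissible profile satisfied the plateau dichotomy, the slice rung `SeparableOrderTwoRigidityL` would hold by name
(`separableOrderTwoRigidityL_of_identity` with S-C `angularLemma_holds`). -/
theorem separableOrderTwoRigidityL_of_forall_dichotomy (hD : ∀ (l : ℕ) (H : ℝ → ℝ), 1 ≤ l → VirialAdmissible l H →
      (∀ a b : ℝ, 0 < a → a < b → ∃ r ∈ Set.Ioo a b, vortAmpL l H r ≠ 0) ∨ (∀ r : ℝ, 0 < r → vortAmpL l H r = 0)) :
    SeparableOrderTwoRigidityL :=
  separableOrderTwoRigidityL_of_identity (orderTwoVirialIdentity_of_forall_dichotomy hD) angularLemma_holds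

/-! ### The window rung up to bridge W / bracket injectivity -/

/-- ★ THE WINDOW RUNG FROM BRIDGE W ALONE (every degree `l ≥ 1`): V-W `virialWindowSilence_holds` and S-C `angularLemma_holds` discharge the
other inputs of `isotypicWindowRigidityL_of_bridges'`. -/
theorem isotypicWindowRigidityL_of_bridgeW' (l n : ℕ) (hl : 1 ≤ l) (hWA : WindowWedgeAnalyticL) : IsotypicWindowRigidityL l n :=
  isotypicWindowRigidityL_of_bridgeW l n hl hWA angularLemma_holds

/-- ★★ THE WINDOW RUNG FROM BRACKET INJECTIVITY ALONE (every degree `l ≥ 1`): crc-p2's `windowWedgeAnalyticL_of_bracketInjective` supplies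
bridge W.  The hypothesis is KEY-NS #210's `BracketInjective` verbatim (all degrees; tribunal T2's proof of record, not yet in the kernel). -/
theorem isotypicWindowRigidityL_of_bracketInjective
    (hinj : ∀ (l n : ℕ) (B : Fin n → E3 → ℝ), 1 ≤ l → (∀ m, IsSolidHarmonic l (B m)) → LinearIndependent ℝ B →
      ∀ w : Fin n → Fin n → ℝ, (∀ y : E3, ∑ m, ∑ m', w m m' * pbr (B m) (B m') y = 0) → ∀ m m', w m m' = w m' m)
    (l n : ℕ) (hl : 1 ≤ l) : IsotypicWindowRigidityL l n :=
  isotypicWindowRigidityL_of_bridgeW' l n hl (windowWedgeAnalyticL_of_bracketInjective hinj)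

end Summit.NavierStokesRegularity.NavierStokesRegularity.Theorems.UnthreadedRigidity.ThreadingJets

end
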